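import Mathlib
import HarnessLib
import HarnessLib.Audit
import Summits.KontsevichZagierPeriods.Statement
import Literature.NumberTheory.Transcendental.KZProductIdeal
import HarnessLib.Audit.Status.Attr

/-!
Route: SelbergAMGM

DORMANT since 2026-08-24T06:56:05Z (reconciler: no traction for 6.6 d (last activity item-proof-filed at 2026-08-17T16:29:15Z); parked, not closed — `ledger route dormant route-KontsevichZagierPeriods-SelbergAMGM --off` to reactivate) — unstaffed, not closed; items shared with open routes are served there. `ledger route dormant <id> --off` reactivates.

# Route SelbergAMGM — Selberg at coupling 1/n fibred over the AM–GM base — isotrivial hexagonal CM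
fibres make Gauss multiplication accessible up to cube roots

It suffices to show X = GammaSector ∧ BetaKernel. GammaSector (THE Γ-SECTOR OF CONJECTURE 1): any
two Beta-monomial
representations [ (0,1)ⁿ, C·Πᵢ xᵢ^(aᵢ−1)(1−xᵢ)^(bᵢ−1) ] (C real algebraic, aᵢ, bᵢ ∈ ℚ_>0, any n, m)
with the same value are
KZ-equivalent — the positive settlement of Neg's Γ-detour bet (item 0312 is, up to the routine
disc↔B(½,½) conversion, an
instance). BetaKernel (THE HONEST REMAINDER): Conjecture 1 for the calculus enlarged by those true
Beta-monomial identities as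
extra relators ("Conjecture 1 modulo the Γ-sector", GPC-strength, not staffed). X ⟺ the summit; the
split makes the Γ-sector
load-bearing. Card realised: selberg-amgm-fibre-cm — GammaSector is attacked through the SELBERG
LADDER AT COUPLING γ = 1/n:
Vieta coordinates turn Sₙ(a,b;1/n) into 6∫u^(a−1)v^(b−1)Gₙ(u,v) over the AM–GM base u^(1/n)+v^(1/n)
< 1 (u = Πxᵢ, v = Π(1−xᵢ));
the fibre period is ISOTRIVIAL CM with corner constant a Beta value: G₃(u,v) = B(⅔,⅔)(1 − u^(1/3) −
v^(1/3)) (certified here to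
1e−12; κ₄ = B(¾,¾)² to 1e−15), so the n = 3 collapse is ONE fixed-curve identity on the hexagonal
curve w³ = c(1−c) (cruxes
FibrePeriodAMGM, SelbergCollapseOneThird); n = 2 is a point fibre and gives Legendre duplication for
ALL rational parameters in
cancellation-free product form (DuplicationProductForm); comparing with Anderson's
change-of-variables proof of Selberg yields the
Gauss-multiplication cocycle, which reaches triplication at 1/9 (item 0312) exactly modulo cube
roots in the KZ period ring
(PositiveCancellation).
Lean: `GammaSector ∧ BetaKernel`

## Assembly
Pure algebra, proved as an `example` in the planner's Sketch.lean (rc 0): GammaSector puts every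
Beta relator [r] − [r'] in
KZ.relations (KZ.Equivalent unfolds to membership), the four move sets are in relations by the
`*_subset_relations` lemmas, so
AddSubgroup.closure_le gives closure(moves ∪ Beta relators) ≤ relations; BetaKernel then yields ker
eval ≤ relations =
KZKernelConjecture, and the summit follows by
Summit.KontsevichZagierPeriods.KernelForm.kontsevichZagierPeriods_of_kzKernelConjecture.

Rationale: WHY THIS LINE. Gauss multiplication is the first place where the fixed H21 calculus might be weaker
than motivic period theory (route Neg, pressure
point (b); Deligne1982HodgeCycles §7 puts the identity on the degree-9 Fermat surface). Selberg's
integral at γ = 1/n CONTAINS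
multiplication by n (Πⱼ Γ(α+j/n) collapses;
`Literature.Analysis.SpecialFunctions.GaussMultiplicationFormula` is proved in the tree) and
Anderson's proof of Selberg (doi:10.1515/form.1991.3.415; AndrewsAskeyRoy1999 §8.4) is nothing but
changes of variables and Dirichlet
integrals, i.e. KZ moves in product form. The new ingredient (card selberg-amgm-fibre-cm) is the
AM–GM fibration: two-dimensional
Mellin uniqueness forces Gₙ(u,v) = κₙ(1 − u^(1/n) − v^(1/n))^(n−2), and a Hodge count done here (on
w⁶ = Disc_(u,v)(e), genus 7, the
eigenspace of de/w has Hodge numbers (0,3), a definite polarisation) shows the rank-3 Appell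
F₁(5/6;1/6,1/6;5/3) local system has
FINITE monodromy — the fibre Jacobian piece is isogenous to the cube of the hexagonal CM curve, so
an algebraic correspondence
(Lefschetz (1,1) on a product of curves) explains (★₃) and the KZ chain is a sheet transfer (route
MultivaluedCoV's engine
SheetTransfer) plus one Newton–Leibniz for the exact part; the constant κ₃ = B(⅔,⅔) is the
degenerate corner fibre, so no
Chowla–Selberg input is needed. Imported areas: random-matrix/Selberg-integral technology (Anderson,
Forrester–Warnaar
arXiv:0710.3981), Hodge theory of cyclic covers / algebraic Appell–Lauricella functions (Sasaki
1977, Cohen–Wolfart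
doi:10.1524/anly.1992.12.34.359), CM periods. What no prior route does: MultivaluedCoV attacks 0312
through the degree-9 Fermat
correspondence (Aoki–Shioda cycles, not of graph type); Neg bets on non-accessibility; LowDimension
0118 is one duplication
instance; here duplication comes for all parameters and triplication is localised to one CM fibre
plus an explicit ℤ/3 torsion
question about the KZ period ring.

RANKED CRUXES. #0 BetaKernel (target) — Conjecture 1 modulo the Γ-sector: every formal ℤ-combination
of integral representations with value 0 lies in the subgroup generated by the four H21 moves
together with the relators [r] − [r'] for Beta-monomial representations r, r' (unit-cube domain,
integrand C·Πᵢ xᵢ^(aᵢ−1)(1−xᵢ)^(bᵢ−1), C real algebraic, aᵢ, bᵢ positive rationals) of equal value.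
With GammaSector it is exactly the summit (Assembly); alone it is the kernel conjecture with a
Γ-oracle — GPC-strength, filed so that the sector is load-bearing, not to be staffed. (why it might
fail: It is Conjecture 1 up to Γ-identities: the strength barriers apply verbatim (regularised MZV
relations, elliptic/η identities are untouched by the Beta relators); false iff some non-Γ identity
is underivable.) [KontsevichZagier2001, HuberMullerStach2017, HuberWustholz2022, Waldschmidt2006]
#2 FibrePeriodAMGM (crux) — THE CM FIBRE (card F1, (★₃) at a rational fibre). For rational u, v > 0
with u^(1/3) + v^(1/3) < 1, let Δ_(u,v)(e) = 18e(e+u+v−1)u − 4e³u + e²(e+u+v−1)² − 4(e+u+v−1)³ −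
27u² (discriminant of t³ − e t² + (e+u+v−1)t − u, the monic cubics F with |F(0)| = u, F(1) = v) and
I(u,v) = {e : Δ > 0, e > 0, e+u+v−1 > 0, e < 3, e < 2+u+v} (= cubics with three distinct roots in
(0,1); one interval numerically). Then [I(u,v), Δ_(u,v)(e)^(−1/6)] is KZ-equivalent to [(0,1), (1 −
u^(1/3) − v^(1/3))·(c(1−c))^(−1/3)]: the discriminant period equals the AM–GM defect times the
corner Beta integral B(⅔,⅔). Values agree to 1e−12 at five fibres (planner num/check_star3.py) and
the identity is a theorem a.e. in (u,v) by Selberg + Gauss + 2-dim Mellin injectivity. Plan: w⁶ =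
Δ_(u,v)(e) has its de/w-eigenspace of Hodge type (0,3) ⇒ finite monodromy ⇒ the piece is isogenous
to E₀³, E₀ : w³ = c(1−c); realise the correspondence by sheets (MultivaluedCoV.SheetTransfer) and
absorb the exact form by one Newton–Leibniz with a rational primitive. [difficulty: L] (why it might
fail: de/w is of the second kind (pure (0,1)-type class): the correspondence to w³=c(1−c) moves it
only up to an exact form df, and the path runs between branch points, so f must be a REAL
semialgebraic primitive with finite endpoint values — may fail as typed.)
[doi:10.1515/form.1991.3.415, AndrewsAskeyRoy1999, doi:10.1524/anly.1992.12.34.359,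
Deligne1982HodgeCycles, KontsevichZagier2001]
#3 SelbergCollapseOneThird (crux) — THE n = 3 COLLAPSE (card (★₃) in total form; the retired A5 of
spectral-straightening-selberg made explicit). For all rational a, b > 0 the Selberg representation
[ (0,1)³, (x₀x₁x₂)^(a−1)((1−x₀)(1−x₁)(1−x₂))^(b−1)(|x₀−x₁||x₀−x₂||x₁−x₂|)^(2/3) ] is KZ-equivalent
to the Beta product [ (0,1)³, 54·x₀^(3a−1)(1−x₀)^(3b−1)·x₁^(3a+3b−1)(1−x₁)·(x₂(1−x₂))^(−1/3) ]
(value C₃Γ(3a)Γ(3b)/Γ(3a+3b+2), C₃ = 54·B(⅔,⅔) = 216π²/Γ(⅓)³, checked to 1e−15 against Selberg's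
formula at five (a,b) and by Monte Carlo at (1,1)). Chain: VietaCoordinatesOneThird (support) → the
fibre identity of crux 2 performed UNIFORMLY over the AM–GM base (after u = p³, v = q³ everything is
rational in (p,q)) → AMGMDirichlet (support). First dimension-3 Γ(⅓)-detour family inside the rules.
[deps: FibrePeriodAMGM, VietaCoordinatesOneThird, AMGMDirichlet] [difficulty: XL] (why it might
fail: Needs crux 2's chain uniformly in (u,v): the correspondence is defined over ℚ(u^(1/3),v^(1/3))
and its sheet/branch structure must vary semialgebraically over the whole AM–GM base, including the
degenerate edges where the fibre interval collapses.) [doi:10.1515/form.1991.3.415,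
AndrewsAskeyRoy1999, arXiv:0710.3981, KontsevichZagier2001]
#4 DuplicationProductForm (crux) — LEGENDRE DUPLICATION FOR ALL RATIONAL PARAMETERS,
CANCELLATION-FREE (card F4 against Anderson's route A at n = 2). For rational a, b > 0: [ (0,1)³,
4(x₀(1−x₀))^(−1/2)·x₁^(2a−1)(1−x₁)^(2b−1)·x₂^(2a+2b−1) ] ~ [ (0,1)×{t₁,t₂>0, t₁+t₂<1},
x₀^(a−½)(1−x₀)^(b−½)·t₁^(a−1)t₂^(−1/2)(1−t₁−t₂)^(b−1) ], i.e. 4·B(½,½)·B(2a,2b)/(2a+2b) =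
B(a+½,b+½)·Γ(a)Γ(½)Γ(b)/Γ(a+b+½) in P (checked to 1e−16 at five (a,b)). Chain on paper (≤ 10 moves):
left = B(½,½) × the n = 2 AM–GM collapse (support SelbergDuplicationHalf, ordered version) ← affine
fibre CoV y = x₁+(x₂−x₁)t of Anderson's joint integral J over {0<x₁<y<x₂<1} → Anderson's
partial-fraction CoV (x₁,x₂) ↦ (t₀,t₁) = (x₁x₂/y, (1−x₁)(1−x₂)/(1−y)) onto the simplex, fibrewise
over y, giving the right side. All maps rational, all exponents rational. [deps:
SelbergDuplicationHalf] [difficulty: M] (why it might fail: As typed: Anderson's map must be shown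
injective with image EXACTLY the open simplex fibrewise and |det| = (x₂−x₁)/(y(1−y)) inside
changeOfVariablesRel's HasFDerivWithinAt/semialgebraic side conditions; a boundary/null-set slip
breaks the literal ∀.) [doi:10.1515/form.1991.3.415, AndrewsAskeyRoy1999, Waldschmidt2006,
KontsevichZagier2001]
#5 GammaSector (crux) — THE Γ-SECTOR OF CONJECTURE 1 (the conjunct this route attacks): any two
Beta-monomial representations (unit-cube domains of any dimensions, integrands C·Πᵢ
xᵢ^(aᵢ−1)(1−xᵢ)^(bᵢ−1) with C real algebraic and aᵢ, bᵢ ∈ ℚ_>0; dimension 0 = algebraic constants)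
with equal value are KZ-equivalent. Values are ℚ̄-multiples of Γ-monomials, so by Rohrlich's
conjecture the true identities are generated by translation, reflection and multiplication;
translation is integration by parts (accessible), reflection is a dimension-1 statement
(LowDimension), multiplication by n is the Selberg ladder (★ₙ) of this route compared with
Anderson's product form, modulo PositiveCancellation. Instances: 0312 (triplication at 1/9),
LowDimension 0118, crux 4. [deps: SelbergCollapseOneThird, DuplicationProductForm,
PositiveCancellation] [difficulty: open-problem] (why it might fail: Rohrlich–Lang is open (unknown
identities may exist); and even the known ones reach specific monomials only through
cancellation/cube roots in the KZ period ring (crux 6) — a 3-torsion unit would make 0312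
underivable.) [Waldschmidt2006, Deligne1982HodgeCycles, KontsevichZagier2001,
doi:10.1515/form.1991.3.415]
#6 PositiveCancellation (crux) — TORSION KILLING (card F3 made a ring statement). In FormalRep with
its product (KZProduct: relations is a two-sided ideal, eval is multiplicative — both proved), if
x³k − y³k is a relation, eval x > 0, eval y > 0 and eval k ≠ 0, then x − y is a relation: positive
cube roots are unique and non-zero-valued classes cancel. Summit-implied (proved from
KZKernelConjecture in the planner's Sketch.lean, 10 lines) and transcendence-free; it is exactly
what turns the Selberg cocycle q(a)q(b) = q(a+b+⅔) (plus translation, reflection) into q(1/9) = 1,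
i.e. item 0312; contains AyoubSpecialisation's PiCancellation shape (k = [π]) as the cube-free
special case. [difficulty: open-problem] (why it might fail: K₀-type rings of measured semialgebraic
sets may have zero divisors or torsion units (cf. Poonen/Borisov zero divisors in K₀(Var)); one
3-torsion unit or a bad k refutes it — and then refutes Conjecture 1 itself.) [KontsevichZagier2001,
HuberWustholz2022, HuberMullerStach2017, Ayoub2015]
#9 SelbergDuplicationHalf (support) — n = 2 AM–GM collapse (fibre = a point; card F4): for rational
a, b > 0, [ (0,1)², (x₀x₁)^(a−1)((1−x₀)(1−x₁))^(b−1)|x₀−x₁| ] ~ [ (0,1)²,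
8x₀^(2a−1)(1−x₀)^(2b−1)x₁^(2a+2b−1) ] (value S₂(a,b;½) = 8B(2a,2b)/(2a+2b)). Five moves: split at
the null diagonal, swap CoV, the CoV (x,y) ↦ (w,t) = (√(xy)/(√(xy)+√((1−x)(1−y))),
√(xy)+√((1−x)(1−y))) from {x<y} ONTO (0,1)² (inverse: x,y = roots of Z² − (1+w²t²−(1−w)²t²)Z + w²t²;
Jacobian |x−y| then 4w(1−w)t³), integrand additivity for the factor 2. [difficulty: provable-now]
[doi:10.1515/form.1991.3.415, KontsevichZagier2001]
#9 VietaCoordinatesOneThird (support) — B1 of the n = 3 chain: the Selberg representation at γ = 1/3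
is KZ-equivalent to [ E, 6·u^(a−1)v^(b−1)Δ(e,u,v)^(−1/6) ] in coordinates (e,u,v) = (Σxᵢ, Πxᵢ,
Π(1−xᵢ)), E = {u,v>0, Δ>0, e>0, e+u+v−1>0, e<3, e<2+u+v}: domain additivity into the 6 ordered cells
(big diagonal null), on each cell the polynomial map x ↦ (e,u,v) is injective with |det| =
Π_(i<j)|xᵢ−xⱼ| = Δ^(1/2), so |Δ|^(1/3)dx = Δ^(−1/6)d(e,u,v); the six images coincide; integrand
additivity collects the factor 6. [difficulty: L] [doi:10.1515/form.1991.3.415, AndrewsAskeyRoy1999,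
KontsevichZagier2001]
#9 AMGMDirichlet (support) — B3 of the n = 3 chain: [ {u,v>0, u^(1/3)+v^(1/3)<1}×(0,1),
6u^(a−1)v^(b−1)(1−u^(1/3)−v^(1/3))·(c(1−c))^(−1/3) ] ~ the Beta product of crux 3, by the CoV u =
p³, v = q³ (|det| = 9p²q²) onto {p,q>0,p+q<1}×(0,1) and the Dirichlet CoV (p,q) = (ws,(1−w)s) (|det|
= s) onto (0,1)³: 6·9·p^(3a−1)q^(3b−1)(1−p−q) ↦ 54·w^(3a−1)(1−w)^(3b−1)s^(3a+3b−1)(1−s).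
[difficulty: provable-now] [AndrewsAskeyRoy1999, KontsevichZagier2001]

TWO-LAYER PLAN. Foreseen glued splits (k ≤ 3, depth 1), filed only when a crux closes:
SelbergCollapseOneThird ⇐ VietaCoordinatesOneThird →
FibreIdentityTotal ([E, 6u^(a−1)v^(b−1)Δ^(−1/6)] ~ [AM–GM base × (0,1),
6u^(a−1)v^(b−1)(1−u^(1/3)−v^(1/3))(c(1−c))^(−1/3)], the
uniform version of crux 2) → AMGMDirichlet (glue = Equivalent.trans). After crux 3 lands:
TriplicationCocycle (Anderson's product
form at n = 3, γ = ⅓: [Sel₃^ord]·[Dir₃(⅓,⅓,⅓)] ~ [Sel₂^ord(a+⅓,b+⅓;⅓)]·[Dir₄(a,⅓,⅓,b)] and the n =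
2, γ = ⅓ step, two CoVs each,
imported from card matrix-model-couplings-anderson-selberg) → TorsionBookkeeping (pure ring algebra
in FormalRep: cocycle +
translation + reflection at ⅓ ⇒ x³k − y³k ∈ relations for the 0312 pair) → PositiveCancellation ⇒
Neg/MultivaluedCoV item 0312
TriplicationAccessible. FibrePeriodAMGM ⇐ CorrespondenceSheets (the explicit cycle C_(u,v) → E₀³) →
ExactPartNewtonLeibniz. The
ladder (★ₙ), n ≥ 4 (κ₄ = B(¾,¾)², lemniscatic) only after n = 3.

KILL CRITERIA. FibrePeriodAMGM refuted (a 1-dim pair with certified-equal values outside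
KZ.relations) refutes the SUMMIT: close
refuted:FibrePeriodAMGM, hand the witness to Neg 0313 and report. FibrePeriodAMGM proved but
SelbergCollapseOneThird refuted ⇒
fibrewise-to-total transfer fails in the calculus: likewise summit-refuting. PositiveCancellation
refuted ⇒ ¬KontsevichZagierPeriods
outright (Sketch: KZKernelConjecture → PositiveCancellation); close and hand to Neg. If Neg 0311 is
PROVED (0312 refuted) while
cruxes 2–4 stand, the torsion reading is confirmed: pivot GammaSector to "Γ-sector modulo 3-torsion"
and close this route
superseded by Neg. 0312 proved by MultivaluedCoV's Fermat correspondence moots the cocycle layer but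
not cruxes 2–4.
DuplicationProductForm failing AS TYPED only forces a restatement (side conditions), not a close.

NOT DECOMPOSED YET. The explicit correspondence C_(u,v) → E₀ (three maps or one cycle; candidates:
the quotient Picard curve W³ = Δ, the root
parametrisation by the genus-1 curve {φ(x)=φ(x')}, φ = (x³+(u+v−1)x−u)/(x²−x)); the exact-form
primitive; the uniform-in-(u,v)
version (child FibreIdentityTotal); Anderson's n = 3 product form and the torsion bookkeeping (layer
2, after crux 3); reflection
B(x,1−x) ~ π/sin πx at rational x (dimension 1, LowDimension's sector); the n ≥ 4 rungs; a
Literature cite-fact for Selberg's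
formula (values only). Nothing here is filed now.

CHEAPEST FALSIFIER. (i) 30-digit failure of (★₃) at one rational fibre — RUN here instead at double
precision: ratio − 1 ∈ [−4e−12, 1e−12] at (u,v) =
(1/27,1/27), (1/8,1/64), (10⁻³,1/5), (1/100,1/50), (1/64,1/64), fibre a single interval each time
(num/check_star3.py); κ₃ = B(⅔,⅔),
C₃ = 54B(⅔,⅔), κ₄ = B(¾,¾)² and the DuplicationProductForm values to 1e−15 (num/check_constants.py).
(ii) The refuter's one-hour
check: compute the monodromy of F₁(5/6;1/6,1/6;5/3) around two divisors (or look it up in Sasaki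
1977 / Cohen–Wolfart 1992,
acq-02349): an element of infinite order kills the isotrivial-CM reading (crux 2's plan, not its
statement). (iii) For crux 4: the
numeric Jacobian/image check of Anderson's n = 2 map at three points.

NUMBERS. κ₂ = 1; κ₃ = B(⅔,⅔) = 4π²/Γ(⅓)³ = 2.05339021794; C₃ = 54κ₃ = 110.883071769 = 216π²/Γ(⅓)³;
κ₄ = B(¾,¾)² = 16π³/Γ(¼)⁴ = 2.87108004418;
S₂(a,b;½) = 8B(2a,2b)/(2a+2b); S₃(1,1;⅓) = 0.0880024 (Monte Carlo 0.08807); 0312 value 2·3^(7/6)π =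
22.637128; Hodge numbers of the
de/w-eigenspace on w⁶ = quartic: (h¹⁰,h⁰¹) = (0,3), genus 7, rank-3 local system = Appell
F₁(5/6;1/6,1/6;5/3); Legendre check
B(⅓,⅓)B(⅔,⅔) = 2√3π. Items at open: 10 (1 target, 5 cruxes, 3 support, 1 assembly).

DEFINITION REQUESTS. None needed for the statements (KZ.IntegralRep, KZ.Equivalent, KZ.relations,
FormalRep product from KZProduct/KZProductIdeal all
exist). Cite-fact wanted (values only, not load-bearing): Selberg's integral formula (Selberg 1944;
AndrewsAskeyRoy1999 Thm 8.1.1)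
and Anderson's Dirichlet-type lemma (doi:10.1515/form.1991.3.415). Literature want filed:
Cohen–Wolfart 1992
doi:10.1524/anly.1992.12.34.359 (acq-02349).

Novelty: Searches (2026-08-15): card + audit searches inherited (zbMATH 'Selberg integral multiplication
formula gamma function' 4 irrelevant,
'Selberg sums Hasse-Davenport' 0; galaxy intelligent pdf on γ=1/n fibres: nothing; AAR §8.4 and
arXiv:0710.3981 pp. 7–10 read by the
auditor); this session: lit search --source crossref "algebraic Appell Lauricella hypergeometric
functions Cohen Wolfart" (10 rows:
doi:10.1524/anly.1992.12.34.359 Cohen–Wolfart 1992, doi:10.14492/hokmj/2022-668, Beukers–Wolfart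
1988; paywalled → acq-02349);
lit search --source zbmath "finiteness monodromy Appell F_D Sasaki" (0); lit galaxy search --star
all "algebraic Appell-Lauricella"
(1 irrelevant panama row; pdf/crabby stars congested), two longer galaxy phrases (0); local searchd
unreachable (connection reset)
— recorded in NOTES. lean search: GaussMultiplicationFormula(_holds) present; no Selberg integral,
no Rohrlich Γ-conjecture in tree.
Nearest prior art found: Anderson 1991 doi:10.1515/form.1991.3.415 and AndrewsAskeyRoy1999 §8.4
(Selberg by changes of variables —
route A, owned by card matrix-model-couplings-anderson-selberg); Cohen–Wolfart 1992 / Sasaki 1977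
(finite-monodromy Appell–Lauricella
functions, the natural home of (★₃)'s algebraicity); Deligne1982HodgeCycles §7 (Γ-identities from
Fermat Hodge cycles); in-tree
routes MultivaluedCoV (0312 via Fermat sheets) and GaussManinCertificates (CM fibre of the Legendre
family).
Delta: nobody fibres Selberg at γ = 1/n over (Πxᵢ, Π(1−xᵢ)); the resulting v  [refs: 10.1524/anly.1992.12.34.359, 10.14492/hokmj/2022-668, 10.1515/form.1991.3.415, 0710.3981, doi:10.1524/anly.1992.12.34.359, doi:10.14492/hokmj/2022-668, doi:10.1515/form.1991.3.415, AndrewsAskeyRoy1999]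

Barriers (technique_class: amgm-fibration isotrivial-cm-fibre torsion-criterion): - technique_class: amgm-fibration isotrivial-cm-fibre torsion-criterion
- Literature.Barriers.KontsevichZagierPeriods.noSemialgebraicPrimitive_inv_sub_two: evaded for
cruxes 3–4 and the supports (changes of variables, null sets and additivity only; the coarea over
(u,v) has Jacobian 1 and is never a primitive); crux 2 needs ONE Newton–Leibniz whose primitive is a
rational function on the curve (algebraic, admissible) — the bet is that the exact part of the
correspondence pull-back has such a primitive with finite endpoint values; no variable is integrated
out anywhere.
- Literature.Barriers.KontsevichZagierPeriods.cressonViuSos_prop_3_2: respected — every map acts on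
open cells after dissection (6 Weyl cells, 2 sheets, simplices); dimension ≤ 3, where the
Hauptvermutung hypothesis is vacuous.
- Literature.Barriers.KontsevichZagierPeriods.kzConjecture_implies_oddZetaAlgIndep: bites only
BetaKernel (target, GPC-strength, said openly) and, through Rohrlich–Lang, the general GammaSector;
cruxes 2–4, 6 are statements about specific equal-valued representations or ring structure and prove
no independence result.
- Literature.Barriers.KontsevichZagierPeriods.kzConjecture_implies_twoPiI_log_algIndep: as above; no
logarithm enters (all exponents rational, all constants Beta values).
- Literature.Barriers.KontsevichZagierPeriods.kzConjecture_implies_ellipticPeriods_algIndep: as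
above; the only elliptic curve is the CM curve w³ = c(1−c), where Chudnovsky's theorem already gives
trdeg 2

Novelty grade: new-combination — route-review grade (refuter dc227247), PROVISIONAL: searchd local/remote DOWN rc75 all session; one galaxy intelligent query over web PDFs ('Selberg integral γ=1/3 via elementary symmetric functions; discriminant^{−1/6} over cubics with prescribed F(0),F(1); Gauss multiplication from Selberg/Dixon–A (refuter refuter-rreview-route-KontsevichZagierPe-dc227247-0, 2026-08-15T14:02:51Z; prior: doi:10.1515/form.1991.3.415, AndrewsAskeyRoy1999 §8.4, doi:10.1524/anly.1992.12.34.359, Sasaki1977, Deligne1982HodgeCycles §7, arXiv:0710.3981)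

History (route lifecycle, newest last):
- 2026-08-16T02:18:03Z · AUTO-CRUX: 1 conjecture-grade item(s) promoted to crux (BetaKernel) — refuter vetting / tiering apply (operator:999:1362873)
- 2026-08-16T04:09:32Z · AUTO-CRUX (backfill): BetaKernel — hypotheses of the deciding theorem that nothing in the route derives are cruxes (operator:999:1085951)
- 2026-08-24T06:56:05Z · DORMANT — reconciler: no traction for 6.6 d (last activity item-proof-filed at 2026-08-17T16:29:15Z); parked, not closed — `ledger route dormant route-KontsevichZagierPer (operator:999:3853994)

sub-problem: KontsevichZagierPeriods · status: dormant · opened planner-plancard-KontsevichZagierPeriods-Kont-f1f46093-0 2026-08-15T11:41:52Z · rev 2 · ledger route-KontsevichZagierPeriods-SelbergAMGM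
GENERATED by the gate from the ledger (D-0016/17). Provers cite these decls: `theorem foo : Summit.KontsevichZagierPeriods.KontsevichZagierPeriods.Theses.SelbergAMGM.<Decl> := …` in Summits/KontsevichZagierPeriods/KontsevichZagierPeriods/Theorems/<Name>.lean.
-/

namespace Summit.KontsevichZagierPeriods.KontsevichZagierPeriods.Theses.SelbergAMGM

open scoped BigOperators Topology Manifold Classical MeasureTheory ProbabilityTheory Matrix InnerProductSpace ComplexConjugate ContinuousMap
open Filter Set Function TopologicalSpace MeasureTheory

attribute [summit_statement] _root_.KontsevichZagierPeriods

open Literature Periods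

/-- item stmt-KontsevichZagierPeriods-5616 · crux (kind.auto-crux: conjecture-grade) · rank 0 · open · by planner
why it might fail: It is Conjecture 1 up to Γ-identities: the strength barriers apply verbatim (regularised MZV relations, elliptic/η identities are untouched by the Beta relators); false iff some non-Γ identity is underivable.
sources: KontsevichZagier2001, HuberMullerStach2017, HuberWustholz2022, Waldschmidt2006
[target] Conjecture 1 modulo the Γ-sector: every formal ℤ-combination of integral representations
with value 0 lies in the subgroup generated by the four H21 moves together with the relators [r] −
[r'] for Beta-monomial representations r, r' (unit-cube domain, integrand C·Πᵢ
xᵢ^(aᵢ−1)(1−xᵢ)^(bᵢ−1), C real algebraic, aᵢ, bᵢ positive rationals) of equal value. With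
GammaSector it is exactly the summit (Assembly); alone it is the kernel conjecture with a Γ-oracle —
GPC-strength, filed so that the sector is load-bearing, not to be staffed. -/
@[route_item "route-KontsevichZagierPeriods-SelbergAMGM", crux]
def BetaKernel : Prop :=
  ∀ c : Literature.NumberTheory.Transcendental.KZ.FormalRep, Literature.NumberTheory.Transcendental.KZ.eval c = 0 → c ∈ AddSubgroup.closure (Literature.NumberTheory.Transcendental.KZ.domainAddRel ∪ Literature.NumberTheory.Transcendental.KZ.integrandAddRel ∪ Literature.NumberTheory.Transcendental.KZ.changeOfVariablesRel ∪ Literature.NumberTheory.Transcendental.KZ.newtonLeibnizRel ∪ {c | ∃ (n m : ℕ) (r : Literature.NumberTheory.Transcendental.KZ.IntegralRep n) (r' : Literature.NumberTheory.Transcendental.KZ.IntegralRep m), (∃ (C : ℝ) (a b : Fin n → ℚ), IsAlgebraic ℚ C ∧ (∀ i, 0 < a i ∧ 0 < b i) ∧ r.domain = {x | ∀ i, x i ∈ Set.Ioo (0:ℝ) 1} ∧ Set.EqOn r.integrand (fun x => C * ∏ i, ((x i) ^ ((a i : ℝ) - 1) * (1 - x i) ^ ((b i : ℝ) - 1)))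 r.domain) ∧ (∃ (C : ℝ) (a b : Fin m → ℚ), IsAlgebraic ℚ C ∧ (∀ i, 0 < a i ∧ 0 < b i) ∧ r'.domain = {x | ∀ i, x i ∈ Set.Ioo (0:ℝ) 1} ∧ Set.EqOn r'.integrand (fun x => C * ∏ i, ((x i) ^ ((a i : ℝ) - 1) * (1 - x i) ^ ((b i : ℝ) - 1))) r'.domain) ∧ r.value = r'.value ∧ c = Literature.NumberTheory.Transcendental.KZ.of r - Literature.NumberTheory.Transcendental.KZ.of r'})

/-- item stmt-KontsevichZagierPeriods-5617 · crux · rank 2 · open · by planner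
why it might fail: de/w is of the second kind (pure (0,1)-type class): the correspondence to w³=c(1−c) moves it only up to an exact form df, and the path runs between branch points, so f must be a REAL semialgebraic primitive with finite endpoint values — may fail as typed.
sources: doi:10.1515/form.1991.3.415, AndrewsAskeyRoy1999, doi:10.1524/anly.1992.12.34.359, Deligne1982HodgeCycles, KontsevichZagier2001
[crux] THE CM FIBRE (card F1, (★₃) at a rational fibre). For rational u, v > 0 with u^(1/3) +
v^(1/3) < 1, let Δ_(u,v)(e) = 18e(e+u+v−1)u − 4e³u + e²(e+u+v−1)² − 4(e+u+v−1)³ − 27u² (discriminant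
of t³ − e t² + (e+u+v−1)t − u, the monic cubics F with |F(0)| = u, F(1) = v) and I(u,v) = {e : Δ >
0, e > 0, e+u+v−1 > 0, e < 3, e < 2+u+v} (= cubics with three distinct roots in (0,1); one interval
numerically). Then [I(u,v), Δ_(u,v)(e)^(−1/6)] is KZ-equivalent to [(0,1), (1 − u^(1/3) −
v^(1/3))·(c(1−c))^(−1/3)]: the discriminant period equals the AM–GM defect times the corner Beta
integral B(⅔,⅔). Values agree to 1e−12 at five fibres (planner num/check_star3.py) and the identity
is a theorem a.e. in (u,v) by Selberg + Gauss + 2-dim Mellin injectivity. Plan: w⁶ = Δ_(u,v)(e) has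
its de/w-eigenspace of Hodge type (0,3) ⇒ finite monodromy ⇒ the piece is isogenous to E₀³, E₀ : w³
= c(1−c); realise the correspondence by sheets (MultivaluedCoV.SheetTransfer) and absorb the exact
form by one Newton–Leibniz with a rational primitive. [difficulty: L] -/
@[route_item "route-KontsevichZagierPeriods-SelbergAMGM"]
def FibrePeriodAMGM : Prop :=
  ∀ u v : ℚ, 0 < u → 0 < v → (u : ℝ) ^ ((1:ℝ) / 3) + (v : ℝ) ^ ((1:ℝ) / 3) < 1 → ∀ (r r' : Literature.NumberTheory.Transcendental.KZ.IntegralRep 1), r.domain = {x | 0 < 18 * x 0 * (x 0 + (u:ℝ) + (v:ℝ) - 1) * (u:ℝ) - 4 * x 0 ^ 3 * (u:ℝ) + x 0 ^ 2 * (x 0 + (u:ℝ) + (v:ℝ) - 1) ^ 2 - 4 * (x 0 + (u:ℝ) + (v:ℝ) - 1) ^ 3 - 27 * (u:ℝ) ^ 2 ∧ 0 < x 0 ∧ 0 < x 0 + (u:ℝ) + (v:ℝ) - 1 ∧ x 0 < 3 ∧ x 0 < 2 + (u:ℝ) + (v:ℝ)} → Set.EqOn r.integrand (fun x => (18 * x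 0 * (x 0 + (u:ℝ) + (v:ℝ) - 1) * (u:ℝ) - 4 * x 0 ^ 3 * (u:ℝ) + x 0 ^ 2 * (x 0 + (u:ℝ) + (v:ℝ) - 1) ^ 2 - 4 * (x 0 + (u:ℝ) + (v:ℝ) - 1) ^ 3 - 27 * (u:ℝ) ^ 2) ^ (-(1:ℝ) / 6)) r.domain → r'.domain = {x | x 0 ∈ Set.Ioo (0:ℝ) 1} → Set.EqOn r'.integrand (fun x => (1 - (u:ℝ) ^ ((1:ℝ) / 3) - (v:ℝ) ^ ((1:ℝ) / 3)) * (x 0 * (1 - x 0)) ^ (-(1:ℝ) / 3)) r'.domain → Literature.NumberTheory.Transcendental.KZ.Equivalent r r'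

/-- item stmt-KontsevichZagierPeriods-5618 · crux · rank 3 · open · by planner
why it might fail: Needs crux 2's chain uniformly in (u,v): the correspondence is defined over ℚ(u^(1/3),v^(1/3)) and its sheet/branch structure must vary semialgebraically over the whole AM–GM base, including the degenerate edges where the fibre interval collapses.
sources: doi:10.1515/form.1991.3.415, AndrewsAskeyRoy1999, arXiv:0710.3981, KontsevichZagier2001
[crux] THE n = 3 COLLAPSE (card (★₃) in total form; the retired A5 of spectral-straightening-selberg
made explicit). For all rational a, b > 0 the Selberg representation [ (0,1)³,
(x₀x₁x₂)^(a−1)((1−x₀)(1−x₁)(1−x₂))^(b−1)(|x₀−x₁||x₀−x₂||x₁−x₂|)^(2/3) ] is KZ-equivalent to the Beta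
product [ (0,1)³, 54·x₀^(3a−1)(1−x₀)^(3b−1)·x₁^(3a+3b−1)(1−x₁)·(x₂(1−x₂))^(−1/3) ] (value
C₃Γ(3a)Γ(3b)/Γ(3a+3b+2), C₃ = 54·B(⅔,⅔) = 216π²/Γ(⅓)³, checked to 1e−15 against Selberg's formula at
five (a,b) and by Monte Carlo at (1,1)). Chain: VietaCoordinatesOneThird (support) → the fibre
identity of crux 2 performed UNIFORMLY over the AM–GM base (after u = p³, v = q³ everything is
rational in (p,q)) → AMGMDirichlet (support). First dimension-3 Γ(⅓)-detour family inside the rules.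
[deps: FibrePeriodAMGM, VietaCoordinatesOneThird, AMGMDirichlet] [difficulty: XL] -/
@[route_item "route-KontsevichZagierPeriods-SelbergAMGM"]
def SelbergCollapseOneThird : Prop :=
  ∀ a b : ℚ, 0 < a → 0 < b → ∀ (r r' : Literature.NumberTheory.Transcendental.KZ.IntegralRep 3), r.domain = {x | ∀ i, x i ∈ Set.Ioo (0:ℝ) 1} → Set.EqOn r.integrand (fun x => (x 0 * x 1 * x 2) ^ ((a : ℝ) - 1) * ((1 - x 0) * (1 - x 1) * (1 - x 2)) ^ ((b : ℝ) - 1) * (|x 0 - x 1| * |x 0 - x 2| * |x 1 - x 2|) ^ ((2:ℝ) / 3)) r.domain → r'.domain = {x | ∀ i, x i ∈ Set.Ioo (0:ℝ) 1} → Set.EqOn r'.integrand (fun x => 54 * (x 0) ^ (3 * (a : ℝ) - 1) * (1 - x 0) ^ (3 * (b : ℝ) - 1) * (x 1) ^ (3 * (a : ℝ) + 3 * (b : ℝ) - 1) * (1 - x 1) * (x 2 * (1 - x 2)) ^ (-(1:ℝ) / 3)) r'.domain → Literature.NumberTheory.Transcendental.KZ.Equivalent r r'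

/-- item stmt-KontsevichZagierPeriods-5619 · crux · rank 4 · open · by planner
why it might fail: As typed: Anderson's map must be shown injective with image EXACTLY the open simplex fibrewise and |det| = (x₂−x₁)/(y(1−y)) inside changeOfVariablesRel's HasFDerivWithinAt/semialgebraic side conditions; a boundary/null-set slip breaks the literal ∀.
sources: doi:10.1515/form.1991.3.415, AndrewsAskeyRoy1999, Waldschmidt2006, KontsevichZagier2001
[crux] LEGENDRE DUPLICATION FOR ALL RATIONAL PARAMETERS, CANCELLATION-FREE (card F4 against
Anderson's route A at n = 2). For rational a, b > 0: [ (0,1)³,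
4(x₀(1−x₀))^(−1/2)·x₁^(2a−1)(1−x₁)^(2b−1)·x₂^(2a+2b−1) ] ~ [ (0,1)×{t₁,t₂>0, t₁+t₂<1},
x₀^(a−½)(1−x₀)^(b−½)·t₁^(a−1)t₂^(−1/2)(1−t₁−t₂)^(b−1) ], i.e. 4·B(½,½)·B(2a,2b)/(2a+2b) =
B(a+½,b+½)·Γ(a)Γ(½)Γ(b)/Γ(a+b+½) in P (checked to 1e−16 at five (a,b)). Chain on paper (≤ 10 moves):
left = B(½,½) × the n = 2 AM–GM collapse (support SelbergDuplicationHalf, ordered version) ← affine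
fibre CoV y = x₁+(x₂−x₁)t of Anderson's joint integral J over {0<x₁<y<x₂<1} → Anderson's
partial-fraction CoV (x₁,x₂) ↦ (t₀,t₁) = (x₁x₂/y, (1−x₁)(1−x₂)/(1−y)) onto the simplex, fibrewise
over y, giving the right side. All maps rational, all exponents rational. [deps:
SelbergDuplicationHalf] [difficulty: M] -/
@[route_item "route-KontsevichZagierPeriods-SelbergAMGM"]
def DuplicationProductForm : Prop :=
  ∀ a b : ℚ, 0 < a → 0 < b → ∀ (r r' : Literature.NumberTheory.Transcendental.KZ.IntegralRep 3), r.domain = {x | ∀ i, x i ∈ Set.Ioo (0:ℝ) 1} → Set.EqOn r.integrand (fun x => 4 * (x 0 * (1 - x 0)) ^ (-(1:ℝ) / 2) * (x 1) ^ (2 * (a : ℝ) - 1) * (1 - x 1) ^ (2 * (b : ℝ) - 1) * (x 2) ^ (2 * (a : ℝ) + 2 * (b : ℝ) - 1)) r.domain → r'.domain = {x | x 0 ∈ Set.Ioo (0:ℝ) 1 ∧ 0 < x 1 ∧ 0 < x 2 ∧ x 1 + x 2 < 1} → Set.EqOn r'.integrand (fun x => (x 0) ^ ((a : ℝ) - 1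 / 2) * (1 - x 0) ^ ((b : ℝ) - 1 / 2) * (x 1) ^ ((a : ℝ) - 1) * (x 2) ^ (-(1:ℝ) / 2) * (1 - x 1 - x 2) ^ ((b : ℝ) - 1)) r'.domain → Literature.NumberTheory.Transcendental.KZ.Equivalent r r'

/-- item stmt-KontsevichZagierPeriods-5620 · crux · rank 5 · open · by planner
why it might fail: Rohrlich–Lang is open (unknown identities may exist); and even the known ones reach specific monomials only through cancellation/cube roots in the KZ period ring (crux 6) — a 3-torsion unit would make 0312 underivable.
sources: Waldschmidt2006, Deligne1982HodgeCycles, KontsevichZagier2001, doi:10.1515/form.1991.3.415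
[crux] THE Γ-SECTOR OF CONJECTURE 1 (the conjunct this route attacks): any two Beta-monomial
representations (unit-cube domains of any dimensions, integrands C·Πᵢ xᵢ^(aᵢ−1)(1−xᵢ)^(bᵢ−1) with C
real algebraic and aᵢ, bᵢ ∈ ℚ_>0; dimension 0 = algebraic constants) with equal value are
KZ-equivalent. Values are ℚ̄-multiples of Γ-monomials, so by Rohrlich's conjecture the true
identities are generated by translation, reflection and multiplication; translation is integration
by parts (accessible), reflection is a dimension-1 statement (LowDimension), multiplication by n is
the Selberg ladder (★ₙ) of this route compared with Anderson's product form, modulo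
PositiveCancellation. Instances: 0312 (triplication at 1/9), LowDimension 0118, crux 4. [deps:
SelbergCollapseOneThird, DuplicationProductForm, PositiveCancellation] [difficulty: open-problem] -/
@[route_item "route-KontsevichZagierPeriods-SelbergAMGM", crux]
def GammaSector : Prop :=
  ∀ ⦃n m : ℕ⦄ (r : Literature.NumberTheory.Transcendental.KZ.IntegralRep n) (r' : Literature.NumberTheory.Transcendental.KZ.IntegralRep m), (∃ (C : ℝ) (a b : Fin n → ℚ), IsAlgebraic ℚ C ∧ (∀ i, 0 < a i ∧ 0 < b i) ∧ r.domain = {x | ∀ i, x i ∈ Set.Ioo (0:ℝ) 1} ∧ Set.EqOn r.integrand (fun x => C * ∏ i, ((x i) ^ ((a i : ℝ) - 1) * (1 - x i) ^ ((b i : ℝ) - 1))) r.domain) → (∃ (C : ℝ) (a b : Fin m → ℚ), IsAlgebraic ℚ C ∧ (∀ i, 0 < a i ∧ 0 < b i) ∧ r'.domain = {x | ∀ i, x i ∈ Set.Ioo (0:ℝ) 1} ∧ Set.EqOn r'.integrand (fun x => C * ∏ i, ((x i) ^ ((a i : ℝ) - 1) * (1 - x i) ^ ((b i : ℝ) - 1)))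 r'.domain) → r.value = r'.value → Literature.NumberTheory.Transcendental.KZ.Equivalent r r'

/-- item stmt-KontsevichZagierPeriods-5621 · crux · rank 6 · open · by planner
why it might fail: K₀-type rings of measured semialgebraic sets may have zero divisors or torsion units (cf. Poonen/Borisov zero divisors in K₀(Var)); one 3-torsion unit or a bad k refutes it — and then refutes Conjecture 1 itself.
sources: KontsevichZagier2001, HuberWustholz2022, HuberMullerStach2017, Ayoub2015
[crux] TORSION KILLING (card F3 made a ring statement). In FormalRep with its product (KZProduct:
relations is a two-sided ideal, eval is multiplicative — both proved), if x³k − y³k is a relation,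
eval x > 0, eval y > 0 and eval k ≠ 0, then x − y is a relation: positive cube roots are unique and
non-zero-valued classes cancel. Summit-implied (proved from KZKernelConjecture in the planner's
Sketch.lean, 10 lines) and transcendence-free; it is exactly what turns the Selberg cocycle q(a)q(b)
= q(a+b+⅔) (plus translation, reflection) into q(1/9) = 1, i.e. item 0312; contains
AyoubSpecialisation's PiCancellation shape (k = [π]) as the cube-free special case. [difficulty:
open-problem] -/
@[route_item "route-KontsevichZagierPeriods-SelbergAMGM", crux]
def PositiveCancellation : Prop :=
  ∀ x y k : Literature.NumberTheory.Transcendental.KZ.FormalRep, x * x * x * k - y * y * y * k ∈ Literature.NumberTheory.Transcendental.KZ.relations → 0 < Literature.NumberTheory.Transcendental.KZ.eval x → 0 < Literature.NumberTheory.Transcendental.KZ.eval y → Literature.NumberTheory.Transcendental.KZ.eval k ≠ 0 → x - y ∈ Literature.NumberTheory.Transcendental.KZ.relations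

/-- item stmt-KontsevichZagierPeriods-5622 · support · rank 9 · closed · proved by Summit.KontsevichZagierPeriods.SelbergAMGM.selbergDuplicationHalf_proof @ fe40ad7dc307 (prover) · by planner
sources: doi:10.1515/form.1991.3.415, KontsevichZagier2001
[support] n = 2 AM–GM collapse (fibre = a point; card F4): for rational a, b > 0, [ (0,1)²,
(x₀x₁)^(a−1)((1−x₀)(1−x₁))^(b−1)|x₀−x₁| ] ~ [ (0,1)², 8x₀^(2a−1)(1−x₀)^(2b−1)x₁^(2a+2b−1) ] (value
S₂(a,b;½) = 8B(2a,2b)/(2a+2b)). Five moves: split at the null diagonal, swap CoV, the CoV (x,y) ↦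
(w,t) = (√(xy)/(√(xy)+√((1−x)(1−y))), √(xy)+√((1−x)(1−y))) from {x<y} ONTO (0,1)² (inverse: x,y =
roots of Z² − (1+w²t²−(1−w)²t²)Z + w²t²; Jacobian |x−y| then 4w(1−w)t³), integrand additivity for
the factor 2. [difficulty: provable-now] -/
@[route_item "route-KontsevichZagierPeriods-SelbergAMGM"]
def SelbergDuplicationHalf : Prop :=
  ∀ a b : ℚ, 0 < a → 0 < b → ∀ (r r' : Literature.NumberTheory.Transcendental.KZ.IntegralRep 2), r.domain = {x | ∀ i, x i ∈ Set.Ioo (0:ℝ) 1} → Set.EqOn r.integrand (fun x => (x 0 * x 1) ^ ((a : ℝ) - 1) * ((1 - x 0) * (1 - x 1)) ^ ((b : ℝ) - 1) * |x 0 - x 1|) r.domain → r'.domain = {x | ∀ i, x i ∈ Set.Ioo (0:ℝ) 1} → Set.EqOn r'.integrand (fun x => 8 * (x 0) ^ (2 * (a : ℝ) - 1) * (1 - x 0) ^ (2 * (b : ℝ) - 1) * (x 1) ^ (2 * (a : ℝ) + 2 * (b : ℝ) - 1)) r'.domain → Literature.NumberTheory.Transcendental.KZ.Equivalent r r'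

/-- item stmt-KontsevichZagierPeriods-5623 · support · rank 9 · open · by planner
sources: doi:10.1515/form.1991.3.415, AndrewsAskeyRoy1999, KontsevichZagier2001
[support] B1 of the n = 3 chain: the Selberg representation at γ = 1/3 is KZ-equivalent to [ E,
6·u^(a−1)v^(b−1)Δ(e,u,v)^(−1/6) ] in coordinates (e,u,v) = (Σxᵢ, Πxᵢ, Π(1−xᵢ)), E = {u,v>0, Δ>0,
e>0, e+u+v−1>0, e<3, e<2+u+v}: domain additivity into the 6 ordered cells (big diagonal null), on
each cell the polynomial map x ↦ (e,u,v) is injective with |det| = Π_(i<j)|xᵢ−xⱼ| = Δ^(1/2), so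
|Δ|^(1/3)dx = Δ^(−1/6)d(e,u,v); the six images coincide; integrand additivity collects the factor 6.
[difficulty: L] -/
@[route_item "route-KontsevichZagierPeriods-SelbergAMGM"]
def VietaCoordinatesOneThird : Prop :=
  ∀ a b : ℚ, 0 < a → 0 < b → ∀ (r r' : Literature.NumberTheory.Transcendental.KZ.IntegralRep 3), r.domain = {x | ∀ i, x i ∈ Set.Ioo (0:ℝ) 1} → Set.EqOn r.integrand (fun x => (x 0 * x 1 * x 2) ^ ((a : ℝ) - 1) * ((1 - x 0) * (1 - x 1) * (1 - x 2)) ^ ((b : ℝ) - 1) * (|x 0 - x 1| * |x 0 - x 2| * |x 1 - x 2|) ^ ((2:ℝ) / 3)) r.domain → r'.domain = {y | 0 < y 1 ∧ 0 < y 2 ∧ 0 < 18 * y 0 * (y 0 + y 1 + y 2 - 1) * y 1 - 4 * y 0 ^ 3 * y 1 + y 0 ^ 2 * (y 0 + y 1 + y 2 - 1) ^ 2 - 4 * (y 0 + y 1 + y 2 - 1) ^ 3 - 27 * y 1 ^ 2 ∧ 0 < y 0 ∧ 0 < y 0 + y 1 + y 2 - 1 ∧ y 0 < 3 ∧ y 0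 < 2 + y 1 + y 2} → Set.EqOn r'.integrand (fun y => 6 * (y 1) ^ ((a : ℝ) - 1) * (y 2) ^ ((b : ℝ) - 1) * (18 * y 0 * (y 0 + y 1 + y 2 - 1) * y 1 - 4 * y 0 ^ 3 * y 1 + y 0 ^ 2 * (y 0 + y 1 + y 2 - 1) ^ 2 - 4 * (y 0 + y 1 + y 2 - 1) ^ 3 - 27 * y 1 ^ 2) ^ (-(1:ℝ) / 6)) r'.domain → Literature.NumberTheory.Transcendental.KZ.Equivalent r r'

/-- item stmt-KontsevichZagierPeriods-5624 · support · rank 9 · closed · proved by Summit.KontsevichZagierPeriods.SelbergAMGM.amgmDirichlet_proof @ 960facf49388 (prover) · by planner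
sources: AndrewsAskeyRoy1999, KontsevichZagier2001
[support] B3 of the n = 3 chain: [ {u,v>0, u^(1/3)+v^(1/3)<1}×(0,1),
6u^(a−1)v^(b−1)(1−u^(1/3)−v^(1/3))·(c(1−c))^(−1/3) ] ~ the Beta product of crux 3, by the CoV u =
p³, v = q³ (|det| = 9p²q²) onto {p,q>0,p+q<1}×(0,1) and the Dirichlet CoV (p,q) = (ws,(1−w)s) (|det|
= s) onto (0,1)³: 6·9·p^(3a−1)q^(3b−1)(1−p−q) ↦ 54·w^(3a−1)(1−w)^(3b−1)s^(3a+3b−1)(1−s).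
[difficulty: provable-now] -/
@[route_item "route-KontsevichZagierPeriods-SelbergAMGM"]
def AMGMDirichlet : Prop :=
  ∀ a b : ℚ, 0 < a → 0 < b → ∀ (r r' : Literature.NumberTheory.Transcendental.KZ.IntegralRep 3), r.domain = {y | 0 < y 1 ∧ 0 < y 2 ∧ (y 1) ^ ((1:ℝ) / 3) + (y 2) ^ ((1:ℝ) / 3) < 1 ∧ y 0 ∈ Set.Ioo (0:ℝ) 1} → Set.EqOn r.integrand (fun y => 6 * (y 1) ^ ((a : ℝ) - 1) * (y 2) ^ ((b : ℝ) - 1) * (1 - (y 1) ^ ((1:ℝ) / 3) - (y 2) ^ ((1:ℝ) / 3)) * (y 0 * (1 - y 0)) ^ (-(1:ℝ) / 3)) r.domain → r'.domain = {x | ∀ i, x i ∈ Set.Ioo (0:ℝ) 1} → Set.EqOn r'.integrand (fun x => 54 * (x 0) ^ (3 * (a : ℝ) - 1) * (1 - x 0) ^ (3 * (b : ℝ) - 1) * (x 1) ^ (3 * (a : ℝ) + 3 * (b : ℝ) - 1) * (1 - x 1) * (x 2 * (1 - x 2)) ^ (-(1:ℝ) / 3)) r'.domain → Literature.NumberTheory.Transcendental.KZ.Equivalent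 r r'

/-- item stmt-KontsevichZagierPeriods-5625 · assembly · rank 1 · closed · proved by Summit.KontsevichZagierPeriods.SelbergAMGM.assembly_proof @ 91c486c4e96d (prover) · by planner
sources: KontsevichZagier2001, HuberMullerStach2017
[assembly] GammaSector → BetaKernel → KontsevichZagierPeriods. -/
@[route_item "route-KontsevichZagierPeriods-SelbergAMGM"]
def Assembly : Prop :=
  GammaSector → BetaKernel → KontsevichZagierPeriods

/-! D-0027 §2.1 — DECIDING THEOREM (planner-authored via `route open/edit --closes-file`; by planner-rbadge-KontsevichZagierPeriods-Selberg-6486d645-g2-0 2026-08-15T16:11:20Z):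
its hypotheses are this route's items and its conclusion the sub-problem Statement (glue_lint), and it elaborates with this file. -/

@[closes "route-KontsevichZagierPeriods-SelbergAMGM"] theorem closes (hΓ : GammaSector) (hB : BetaKernel) : KontsevichZagierPeriods := by
  intro n m r r' _ _ hv
  show Literature.NumberTheory.Transcendental.KZ.of r - Literature.NumberTheory.Transcendental.KZ.of r'
      ∈ Literature.NumberTheory.Transcendental.KZ.relations
  have h0 : Literature.NumberTheory.Transcendental.KZ.eval
      (Literature.NumberTheory.Transcendental.KZ.of r - Literature.NumberTheory.Transcendental.KZ.of r') = 0 := by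
    simp [Literature.NumberTheory.Transcendental.KZ.eval_of, hv]
  refine (AddSubgroup.mem_closure.1 (hB _ h0)) Literature.NumberTheory.Transcendental.KZ.relations ?_
  rintro c ((((hc | hc) | hc) | hc) | ⟨k, l, s, s', hs, hs', hval, rfl⟩)
  · exact Literature.NumberTheory.Transcendental.KZ.domainAddRel_subset_relations hc
  · exact Literature.NumberTheory.Transcendental.KZ.integrandAddRel_subset_relations hc
  · exact Literature.NumberTheory.Transcendental.KZ.changeOfVariablesRel_subset_relations hc
  · exact Literature.NumberTheory.Transcendental.KZ.newtonLeibnizRel_subset_relations hc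
  · exact hΓ s s' hs hs' hval

end Summit.KontsevichZagierPeriods.KontsevichZagierPeriods.Theses.SelbergAMGM
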